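import Literature.Analysis.FluidPDE.StretchedLayerNS
import HarnessLib

/-!
# Decaying `y`-translation covariance of the stretched shear-layer system

Analysis/FluidPDE support file (everything proved; no definitions, no named facts). The stretched
two-dimensional Navier–Stokes system of a strained shear layer (`IsStretchedLayerNSSolutionOn` of
`StretchedLayerNS`: `∂ₜu + u∂ₓu + (v − γy)∂_yu = −∂ₓp + νΔu`, `∂ₜv + u∂ₓv + (v − γy)∂_yv − γv = −∂_yp + νΔv`,
`∂ₓu + ∂_yv = 0`, `L`-periodic in `x`, shear far field) is NOT invariant under rigid `y`-translations (the
compression `−γy∂_y` singles out the plane `y = 0`), but it IS invariant under the DECAYING translation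

  `(u, v, p)(t, x, y) ↦ (u, v, p)(t, x, y − h₀ e^{−γt})`     (`h₀ ∈ ℝ`):

a displaced layer is carried back to `y = 0` by the compression at the rate `γ` (`h′ = −γh`), and the extra
terms `−(h′ + γh)∂_y` cancel (`IsStretchedLayerNSSolutionOn.decayingShift`, on OPEN time sets, where the
one-sided `∂ₜ` is the ordinary derivative). Being a translation of each time slice, the map preserves the
dissipation per unit area EXACTLY (`layerDissipation_yShift`, `meanLayerDissipation_decayingShift`) and the
far field, and it moves the datum `u(0,x,y)` to `u(0,x,y − h₀)`. Consequences recorded for the route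
`MarginalStabilityChain` (items StrainedLayerLaw 3007, StretchedVortexRows 3009, ChainRealisation 14249): the
far-field clauses of the class do not pin the layer's `y`-position, while every dissipation functional is blind
to it — a free normalisation for provers (e.g. centring the vorticity at one instant), harmless for refuters.
(The observation is the standing disprover's, `Cruxes/StrainedLayerLaw/Disproof.lean` §3, there as a docstring
remark; here it is a theorem.)

Contents: slice-derivative bookkeeping under `y`-translation (`dX_yShift`, `dY_yShift`, `lap_yShift`), the chain
rule for the time derivative along the moving frame (`deriv_decayingShift`), the covariance theorem, and the
invariance of `layerDissipation` / `meanLayerDissipation`.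

References: Majda–Bertozzi 2002 §1.4 (the stretched class, eqs. (1.26), (1.34)); the symmetry itself is
folklore (Galilean covariance in the compressive direction of a linear strain flow).
-/

noncomputable section

open Set Function Filter
open _root_.MeasureTheory
open scoped Topology ENNReal

namespace Literature.Analysis.FluidPDE

open StretchedLayer

/-! ### Slice derivatives under a `y`-translation -/

/-- `∂ₓ` commutes with `y`-translation (definitionally). [folklore] -/
theorem dX_yShift (f : ℝ → ℝ → ℝ) (c x y : ℝ) :
    dX (fun a b => f a (b - c)) x y = dX f x (y - c) := rfl

/-- `∂_y` commutes with `y`-translation (no differentiability needed). [folklore] -/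
theorem dY_yShift (f : ℝ → ℝ → ℝ) (c x y : ℝ) :
    dY (fun a b => f a (b - c)) x y = dY f x (y - c) :=
  deriv_comp_sub_const (f := fun s => f x s) (a := c) (x := y)

/-- `∂ₓ` commutes with `y`-translation, as functions. [folklore] -/
theorem dX_yShift_fun (f : ℝ → ℝ → ℝ) (c : ℝ) :
    dX (fun a b => f a (b - c)) = fun x y => dX f x (y - c) := rfl

/-- `∂_y` commutes with `y`-translation, as functions. [folklore] -/
theorem dY_yShift_fun (f : ℝ → ℝ → ℝ) (c : ℝ) :
    dY (fun a b => f a (b - c)) = fun x y => dY f x (y - c) :=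
  funext fun x => funext fun y => dY_yShift f c x y

/-- `Δ` commutes with `y`-translation. [folklore] -/
theorem lap_yShift (f : ℝ → ℝ → ℝ) (c x y : ℝ) :
    lap (fun a b => f a (b - c)) x y = lap f x (y - c) := by
  rw [lap_apply, lap_apply, dX_yShift_fun, dY_yShift_fun, dX_yShift (dX f), dY_yShift (dY f)]

/-! ### The chain rule along the decaying frame -/

/-- The decaying shift `h(t) = h₀e^{−γt}` has `h′ = −γh`. [folklore] -/
theorem hasDerivAt_decayingShift (h₀ γ t : ℝ) :
    HasDerivAt (fun s => h₀ * Real.exp (-γ * s)) (-γ * (h₀ * Real.exp (-γ * t))) t := by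
  have h1 : HasDerivAt (fun s : ℝ => -γ * s) (-γ) t := by simpa using (hasDerivAt_id t).const_mul (-γ)
  have h2 := (h1.exp).const_mul h₀
  refine h2.congr_deriv ?_
  ring

/-- **Time derivative along the decaying frame.** If `u` is jointly `Cⁿ` (`n ≠ 0`) on `S × ℝ²` with `S` open
and `t ∈ S`, then
`∂ₛ[u(s, x, y − h₀e^{−γs})](t) = ∂ₜu(t, x, Y) + γ h₀e^{−γt} ∂_y u(t, x, Y)`, `Y = y − h₀e^{−γt}`. [folklore] -/
theorem deriv_decayingShift {S : Set ℝ} (hS : IsOpen S) {u : ℝ → ℝ → ℝ → ℝ} {n : WithTop ℕ∞}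
    (hu : ContDiffOn ℝ n (fun q : ℝ × ℝ × ℝ => u q.1 q.2.1 q.2.2) (S ×ˢ univ)) (hn : n ≠ 0)
    {t : ℝ} (ht : t ∈ S) (h₀ γ x y : ℝ) :
    deriv (fun s => u s x (y - h₀ * Real.exp (-γ * s))) t =
      dT S u t x (y - h₀ * Real.exp (-γ * t)) +
        γ * (h₀ * Real.exp (-γ * t)) * dY (u t) x (y - h₀ * Real.exp (-γ * t)) := by
  set Y : ℝ := y - h₀ * Real.exp (-γ * t) with hY
  -- the two-variable slice `F (s, Y) = u s x Y` is differentiable at `(t, Y)`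
  set F : ℝ × ℝ → ℝ := fun q => u q.1 x q.2 with hF
  have hFd : ContDiffOn ℝ n F (S ×ˢ univ) :=
    hu.comp (contDiff_fst.prodMk (contDiff_const.prodMk contDiff_snd)).contDiffOn
      fun q hq => mk_mem_prod (mem_prod.1 hq).1 (mem_univ _)
  have hopen : IsOpen (S ×ˢ (univ : Set ℝ)) := hS.prod isOpen_univ
  have hmem : (t, Y) ∈ S ×ˢ (univ : Set ℝ) := mk_mem_prod ht (mem_univ _)
  have hFat : HasFDerivAt F (fderiv ℝ F (t, Y)) (t, Y) :=
    ((hFd.differentiableOn hn).differentiableAt (hopen.mem_nhds hmem)).hasFDerivAt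
  set F' := fderiv ℝ F (t, Y) with hF'
  -- partial derivatives of `F`
  have h1 : HasDerivAt (fun s => u s x Y) (F' (1, 0)) t := by
    have hc : HasDerivAt (fun s : ℝ => ((s, Y) : ℝ × ℝ)) ((1 : ℝ), (0 : ℝ)) t :=
      (hasDerivAt_id t).prodMk (hasDerivAt_const t Y)
    exact hFat.comp_hasDerivAt t hc
  have h2 : HasDerivAt (fun r => u t x r) (F' (0, 1)) Y := by
    have hc : HasDerivAt (fun r : ℝ => ((t, r) : ℝ × ℝ)) ((0 : ℝ), (1 : ℝ)) Y :=
      (hasDerivAt_const Y t).prodMk (hasDerivAt_id Y)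
    exact hFat.comp_hasDerivAt Y hc
  have hdT : dT S u t x Y = F' (1, 0) := by
    rw [dT_of_isOpen hS u ht]; exact h1.deriv
  have hdY : dY (u t) x Y = F' (0, 1) := h2.deriv
  -- the curve `s ↦ (s, y − h(s))`
  have hcurve : HasDerivAt (fun s : ℝ => ((s, y - h₀ * Real.exp (-γ * s)) : ℝ × ℝ))
      ((1 : ℝ), γ * (h₀ * Real.exp (-γ * t))) t := by
    have := (hasDerivAt_decayingShift h₀ γ t)
    have h3 : HasDerivAt (fun s => y - h₀ * Real.exp (-γ * s)) (γ * (h₀ * Real.exp (-γ * t))) t := by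
      simpa using this.const_sub y
    exact (hasDerivAt_id t).prodMk h3
  have hcomp := hFat.comp_hasDerivAt t hcurve
  have heq : (fun s => u s x (y - h₀ * Real.exp (-γ * s))) =
      F ∘ fun s : ℝ => ((s, y - h₀ * Real.exp (-γ * s)) : ℝ × ℝ) := rfl
  rw [heq, hcomp.deriv, hdT, hdY]
  have hlin : F' ((1 : ℝ), γ * (h₀ * Real.exp (-γ * t))) =
      F' (1, 0) + (γ * (h₀ * Real.exp (-γ * t))) * F' (0, 1) := by
    have : ((1 : ℝ), γ * (h₀ * Real.exp (-γ * t))) =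
        ((1 : ℝ), (0 : ℝ)) + (γ * (h₀ * Real.exp (-γ * t))) • ((0 : ℝ), (1 : ℝ)) := by
      ext <;> simp
    rw [this, map_add, map_smul, smul_eq_mul]
  rw [hlin]

/-! ### Covariance of the class -/

section Covariance

variable {S : Set ℝ} {ν γ ΔU L : ℝ} {u v p : ℝ → ℝ → ℝ → ℝ}

/-- Joint regularity is preserved by the decaying shift. [folklore] -/
theorem contDiffOn_decayingShift {n : WithTop ℕ∞} {f : ℝ → ℝ → ℝ → ℝ}
    (hf : ContDiffOn ℝ n (fun q : ℝ × ℝ × ℝ => f q.1 q.2.1 q.2.2) (S ×ˢ univ)) (h₀ γ : ℝ) :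
    ContDiffOn ℝ n (fun q : ℝ × ℝ × ℝ => f q.1 q.2.1 (q.2.2 - h₀ * Real.exp (-γ * q.1))) (S ×ˢ univ) := by
  have hΦ : ContDiff ℝ n (fun q : ℝ × ℝ × ℝ => (q.1, q.2.1, q.2.2 - h₀ * Real.exp (-γ * q.1))) := by
    refine contDiff_fst.prodMk ((contDiff_fst.comp contDiff_snd).prodMk ?_)
    exact (contDiff_snd.comp contDiff_snd).sub
      (contDiff_const.mul (Real.contDiff_exp.comp (contDiff_const.mul contDiff_fst)))
  exact hf.comp hΦ.contDiffOn fun q hq => mk_mem_prod (mem_prod.1 hq).1 (mem_univ _)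

/-- **Decaying `y`-translation covariance** (open time sets). If `(u, v, p)` solves the stretched layer system on
an open `S`, then so does `(u, v, p)(t, x, y − h₀e^{−γt})` for every `h₀`: with `Y = y − h₀e^{−γt}` and `h′ = −γh`,
`∂ₜ[u(t,x,Y)] = uₜ + γh u_Y` while `(v − γy)u_Y = (v − γY)u_Y − γh u_Y`, so the extra terms cancel; likewise for `v`;
pressure, divergence, periodicity and the far field are read at `Y`. [folklore] -/
theorem IsStretchedLayerNSSolutionOn.decayingShift (hS : IsOpen S)
    (h : IsStretchedLayerNSSolutionOn S ν γ ΔU L u v p) (h₀ : ℝ) :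
    IsStretchedLayerNSSolutionOn S ν γ ΔU L
      (fun t x y => u t x (y - h₀ * Real.exp (-γ * t)))
      (fun t x y => v t x (y - h₀ * Real.exp (-γ * t)))
      (fun t x y => p t x (y - h₀ * Real.exp (-γ * t))) where
  contDiffOn_u := contDiffOn_decayingShift h.contDiffOn_u h₀ γ
  contDiffOn_v := contDiffOn_decayingShift h.contDiffOn_v h₀ γ
  contDiffOn_p := contDiffOn_decayingShift h.contDiffOn_p h₀ γ
  momentum_x t ht x y := by
    have two : (2 : WithTop ℕ∞) ≠ 0 := by norm_num
    rw [dT_of_isOpen hS _ ht, deriv_decayingShift hS h.contDiffOn_u two ht h₀ γ x y]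
    have hm := h.momentum_x t ht x (y - h₀ * Real.exp (-γ * t))
    simp only [dX_yShift, dY_yShift, lap_yShift]
    show dT S u t x (y - h₀ * Real.exp (-γ * t)) +
        γ * (h₀ * Real.exp (-γ * t)) * dY (u t) x (y - h₀ * Real.exp (-γ * t)) +
        u t x (y - h₀ * Real.exp (-γ * t)) * dX (u t) x (y - h₀ * Real.exp (-γ * t)) +
        (v t x (y - h₀ * Real.exp (-γ * t)) - γ * y) * dY (u t) x (y - h₀ * Real.exp (-γ * t)) =
      -dX (p t) x (y - h₀ * Real.exp (-γ * t)) + ν * lap (u t) x (y - h₀ * Real.exp (-γ * t))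
    linear_combination hm
  momentum_y t ht x y := by
    have two : (2 : WithTop ℕ∞) ≠ 0 := by norm_num
    rw [dT_of_isOpen hS _ ht, deriv_decayingShift hS h.contDiffOn_v two ht h₀ γ x y]
    have hm := h.momentum_y t ht x (y - h₀ * Real.exp (-γ * t))
    simp only [dX_yShift, dY_yShift, lap_yShift]
    show dT S v t x (y - h₀ * Real.exp (-γ * t)) +
        γ * (h₀ * Real.exp (-γ * t)) * dY (v t) x (y - h₀ * Real.exp (-γ * t)) +
        u t x (y - h₀ * Real.exp (-γ * t)) * dX (v t) x (y - h₀ * Real.exp (-γ * t)) +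
        (v t x (y - h₀ * Real.exp (-γ * t)) - γ * y) * dY (v t) x (y - h₀ * Real.exp (-γ * t)) -
        γ * v t x (y - h₀ * Real.exp (-γ * t)) =
      -dY (p t) x (y - h₀ * Real.exp (-γ * t)) + ν * lap (v t) x (y - h₀ * Real.exp (-γ * t))
    linear_combination hm
  divFree t ht x y := by
    simp only [dX_yShift, dY_yShift]
    exact h.divFree t ht x _
  periodic_u t ht x y := h.periodic_u t ht x _
  periodic_v t ht x y := h.periodic_v t ht x _
  periodic_p t ht x y := h.periodic_p t ht x _
  tendsto_u_atTop t ht x := (h.tendsto_u_atTop t ht x).comp (tendsto_atTop_add_const_right _ _ tendsto_id)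
  tendsto_u_atBot t ht x := (h.tendsto_u_atBot t ht x).comp (tendsto_atBot_add_const_right _ _ tendsto_id)
  tendsto_v_atTop t ht x := (h.tendsto_v_atTop t ht x).comp (tendsto_atTop_add_const_right _ _ tendsto_id)
  tendsto_v_atBot t ht x := (h.tendsto_v_atBot t ht x).comp (tendsto_atBot_add_const_right _ _ tendsto_id)

end Covariance

/-! ### The dissipation is blind to the layer's position -/

/-- **`y`-translations preserve the dissipation per unit area of a slice**, exactly and unconditionally (an
extended-real identity: the integrand is translated in `y`, and Lebesgue measure is translation invariant).
[folklore] -/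
theorem layerDissipation_yShift (ν L c : ℝ) (a b : ℝ → ℝ → ℝ) :
    layerDissipation ν L (fun x y => a x (y - c)) (fun x y => b x (y - c)) = layerDissipation ν L a b := by
  rw [layerDissipation_def, layerDissipation_def]
  congr 1
  refine setLIntegral_congr_fun measurableSet_Ioc fun x _ => ?_
  simp only [dX_yShift, dY_yShift]
  exact lintegral_sub_right_eq_self
    (fun y => ENNReal.ofReal (dX a x y ^ 2 + dY a x y ^ 2 + dX b x y ^ 2 + dY b x y ^ 2)) c

/-- **The decaying shift preserves the long-time mean dissipation** (slice by slice the dissipation is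
unchanged). [folklore] -/
theorem meanLayerDissipation_decayingShift (ν L h₀ γ : ℝ) (u v : ℝ → ℝ → ℝ → ℝ) :
    meanLayerDissipation ν L (fun t x y => u t x (y - h₀ * Real.exp (-γ * t)))
        (fun t x y => v t x (y - h₀ * Real.exp (-γ * t))) =
      meanLayerDissipation ν L u v := by
  rw [meanLayerDissipation_def, meanLayerDissipation_def]
  simp only [layerDissipation_yShift]

/-- The decaying shift moves the datum: at `t = 0` the shifted field is the `y`-translate by `h₀`. [folklore] -/
theorem decayingShift_zero (f : ℝ → ℝ → ℝ → ℝ) (h₀ γ x y : ℝ) :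
    (fun t x y => f t x (y - h₀ * Real.exp (-γ * t))) 0 x y = f 0 x (y - h₀) := by
  simp

end Literature.Analysis.FluidPDE

end
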